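import Summits.ValiantsHypothesis.ValiantsHypothesis.Theorems.BarrierLeverNaturalProofsSeparateVNPLevel
import Summits.ValiantsHypothesis.ValiantsHypothesis.Theorems.BarrierLeverNPCorpusChainTyped
import Literature.Barriers.ValiantsHypothesis.KRST2022AsPrinted

/-!
# Route BarrierLever — item `NaturalProofsSeparateVNP` (stmt-ValiantsHypothesis-18972) on the
# UNIFORM axis: KRST Def. 4 equations for `VP` versus `VNP`, and infinitely-often hardness

Helper file (`--supports stmt-ValiantsHypothesis-18972`; cell valiant-natproofs, seat val-np-p4 gen 4).
Closes NO item; no definitions.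

Item 18972 (`S` below) is an INFINITELY-OFTEN statement: one definability exponent `b₁`; for every
size exponent `b`, for infinitely many `n`, a level-one natural proof against `SmallCircuits ℂ n b`
with a non-root in the `VNP` slice `SmallDefinable ℂ n b₁`. Kumar–Ramya–Saptharishi–Tengse 2022
phrase equations at the FAMILY level (their Def. 4, typed by val-lit t21 as
`Literature.Barriers.ValiantsHypothesis.HasEfficientEquations F 𝒞`: ONE level `a`, ONE family `P_n`,
nonzero and in `Distinguishers F n a` for large `n`, vanishing on `𝒞 n b` for EVERY `b` eventually).
The landed chain records `HasEfficientEquations ℂ (SmallCircuits ℂ) ⟺ CKRST Question 1.4 (frame)`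
(`NPCorpusChainTyped.question4_frame_iff_hasEfficientEquations`) `⟹ ¬ crux`, the converse being the
a.e./i.o. gap, and the a.e. win–win `PermanentExpHardWith ℂ c m₀ → (crux ∨ S)`
(`NPCorpusChain.naturalProofsSeparateVNP_of_not_crux`; g0's `naturalProofsSeparateVNP_of_question4_frame`).

This file adds what the uniform axis buys:

* §1 `vanishesOnSmallDefinable_of_not_naturalProofsSeparateVNP`: ABSENT the item, every
  efficiently constructible family of equations for `VP` (any level) is, for every `b₁`, eventually a
  family of equations for the `VNP` slice `SmallDefinable ℂ n b₁` — so
  `hasEfficientEquations_smallDefinable_of_not_naturalProofsSeparateVNP :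
  ¬ S → HasEfficientEquations ℂ (SmallCircuits ℂ) → HasEfficientEquations ℂ (SmallDefinable ℂ)`.
* §2 the HARDNESS-FREE door `naturalProofsSeparateVNP_of_hasEfficientEquations :
  HasEfficientEquations ℂ (SmallCircuits ℂ) → ¬ HasEfficientEquations ℂ (SmallDefinable ℂ) → S`
  ("`VP` has Def-4 equations and `VNP` has none ⟹ item 18972"), and the trichotomy reading
  `HasEfficientEquations ℂ (SmallCircuits ℂ) → HasEfficientEquations ℂ (SmallDefinable ℂ) ∨ S`.
* §3 the INFINITELY-OFTEN-hardness win–win: KRST's printed "infinitely often" reading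
  (`PermanentExpHardIO ℂ c`: `per_{j^c}` needs size `2^j` for infinitely many `j`) already gives
  `¬ HasEfficientEquations ℂ (SmallDefinable ℂ)` (t21's `KRST2022_not_hasEfficientEquations_VNP_io`),
  hence `naturalProofsSeparateVNP_of_hasEfficientEquations_of_permanentExpHardIO :
  HasEfficientEquations ℂ (SmallCircuits ℂ) → PermanentExpHardIO ℂ c → S` and the CKRST Q1.4 form —
  whereas the i.o. form of the crux's failure together with i.o. hardness gives nothing (the two
  infinite sets of `n` need not meet); the general mixing lemma is
  `naturalProofsSeparateVNP_of_equations_of_io_hitting` (equations a.e. × `VNP`-hitting i.o.).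
* §4 contrapositives for the cell's GAP-LEDGER row N4: `¬ S → PermanentExpHardIO ℂ c →
  ¬ HasEfficientEquations ℂ (SmallCircuits ℂ)` — absent the item, KRST §4 Open Problem 1 holds AS
  PRINTED already under infinitely-often hardness of the permanent (the route's `KRSTForVP`, which
  `¬ S` also gives — `krstForVP_of_not_naturalProofsSeparateVNP` — needs almost-everywhere hardness
  and concludes the stronger crux).

Honest framing: every hypothesis here (`HasEfficientEquations ℂ (SmallCircuits ℂ)` = "FSV Question 6
fails uniformly", `¬ HasEfficientEquations ℂ (SmallDefinable ℂ)`, `PermanentExpHardIO`) is OPEN in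
print and in the tree; item 18972 stays OPEN (it implies `VP ≠ VNP`,
`valiantsHypothesis_of_naturalProofsSeparateVNP`); nothing here is progress on `VP ≠ VNP`.

References: [KumarRamyaSaptharishiTengse2022] Def. 4, Thm MainThm, §3.5 (concluding paragraph,
"infinitely often"), §4 Open Problems 1–3; [ChatterjeeKumarRamyaSaptharishiTengse2020] Question 1.4;
[ForbesShpilkaVolk2018] Thm. 4, Question 6.
-/

-- layout Summits/ValiantsHypothesis/ValiantsHypothesis forces the duplicated namespace component
set_option linter.dupNamespace false

noncomputable section

namespace Summit.ValiantsHypothesis.ValiantsHypothesis.Theorems.BarrierLever.NaturalProofsSeparateVNP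

open Literature.Barriers.ValiantsHypothesis Literature.Computability.AlgebraicComplexity MvPolynomial
open Summit.ValiantsHypothesis.ValiantsHypothesis.Theses

/-! ### §1 Absent the item, equations for `VP` are equations for `VNP` -/

/-- **Pointwise transfer.** If item 18972 FAILS, then any family `P_n` that is eventually nonzero and
of level `a`, and that vanishes on `SmallCircuits ℂ n b` for every `b` eventually in `n` (a KRST
Def-4 family of equations for `VP`), vanishes for every `b₁`, eventually in `n`, on the whole `VNP`
slice `SmallDefinable ℂ n b₁`. (Otherwise some `b₁` has non-roots in `SmallDefinable ℂ n b₁` for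
infinitely many `n`, and at those `n` the `P_n` are level-`a` separating natural proofs — the level-`a`
form of the item, which is the item by `naturalProofsSeparateVNP_of_level`.)
[cite: KumarRamyaSaptharishiTengse2022, Def. 4 and §4] [cite: ForbesShpilkaVolk2018, Question 6] -/
theorem vanishesOnSmallDefinable_of_not_naturalProofsSeparateVNP
    (hS : ¬ BarrierLever.NaturalProofsSeparateVNP) {a : ℕ}
    {P : (n : ℕ) → MvPolynomial (degLEMonomials n) ℂ}
    (hP : ∃ n₁ : ℕ, ∀ n : ℕ, n₁ ≤ n → P n ≠ 0 ∧ P n ∈ Distinguishers ℂ n a)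
    (hvan : ∀ b : ℕ, ∃ n₀ : ℕ, ∀ n : ℕ, n₀ ≤ n →
      ∀ f ∈ SmallCircuits ℂ n b, eval (coeffVector (degLEMonomials n) f) (P n) = 0)
    (b₁ : ℕ) :
    ∃ n₀ : ℕ, ∀ n : ℕ, n₀ ≤ n →
      ∀ g ∈ SmallDefinable ℂ n b₁, eval (coeffVector (degLEMonomials n) g) (P n) = 0 := by
  by_contra hcon
  push Not at hcon
  obtain ⟨n₁, hn₁⟩ := hP
  refine hS (naturalProofsSeparateVNP_of_level a ⟨b₁, fun b n₀ => ?_⟩)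
  obtain ⟨n₂, hn₂⟩ := hvan b
  obtain ⟨n, hn, g, hg, hne⟩ := hcon (max (max n₀ n₁) n₂)
  have h₀ : n₀ ≤ n := ((le_max_left _ _).trans (le_max_left _ _)).trans hn
  have h₁ : n₁ ≤ n := ((le_max_right _ _).trans (le_max_left _ _)).trans hn
  have h₂ : n₂ ≤ n := (le_max_right _ _).trans hn
  exact ⟨n, h₀, P n, ⟨(hn₁ n h₁).2, (hn₁ n h₁).1, hn₂ n h₂⟩, g, hg, hne⟩

/-- **Family transfer (KRST Def. 4 words).** If item 18972 fails, then efficiently constructible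
equations for `VP` are efficiently constructible equations for `VNP` — the SAME family, the same
level. [cite: KumarRamyaSaptharishiTengse2022, Def. 4 and §4 Open Problems 1–3] -/
theorem hasEfficientEquations_smallDefinable_of_not_naturalProofsSeparateVNP
    (hS : ¬ BarrierLever.NaturalProofsSeparateVNP) (heq : HasEfficientEquations ℂ (SmallCircuits ℂ)) :
    HasEfficientEquations ℂ (SmallDefinable ℂ) := by
  obtain ⟨a, P, hP, hvan⟩ := heq
  exact ⟨a, P, hP, vanishesOnSmallDefinable_of_not_naturalProofsSeparateVNP hS hP hvan⟩

/-! ### §2 The hardness-free door: `VP` has Def-4 equations, `VNP` has none -/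

/-- **Hardness-free door to item 18972.** If `VP` has efficiently constructible equations in the
sense of KRST Def. 4 (= CKRST Question 1.4 answered "yes" in the frame `d = n` = FSV Question 6
failing UNIFORMLY in `n`) while `VNP` has none (the conclusion of KRST's Main Theorem, there derived
from hardness of the permanent), then level-one natural proofs separate `VNP` from `VP` infinitely
often — item 18972. Both hypotheses are printed notions typed by val-lit t21; both are OPEN.
[cite: KumarRamyaSaptharishiTengse2022, Def. 4, Thm MainThm and §4] [cite: ChatterjeeKumarRamyaSaptharishiTengse2020, Question 1.4] -/
theorem naturalProofsSeparateVNP_of_hasEfficientEquations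
    (heq : HasEfficientEquations ℂ (SmallCircuits ℂ))
    (hno : ¬ HasEfficientEquations ℂ (SmallDefinable ℂ)) :
    BarrierLever.NaturalProofsSeparateVNP := by
  by_contra hS
  exact hno (hasEfficientEquations_smallDefinable_of_not_naturalProofsSeparateVNP hS heq)

/-- **Trichotomy reading.** Efficiently constructible equations for `VP` are either (eventually)
equations for `VNP` as well — and then certify no separation — or item 18972 holds (hence
`VP ≠ VNP`, `valiantsHypothesis_of_naturalProofsSeparateVNP`).
[cite: KumarRamyaSaptharishiTengse2022, §4 Open Problems 2–3] -/
theorem hasEfficientEquations_smallDefinable_or_naturalProofsSeparateVNP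
    (heq : HasEfficientEquations ℂ (SmallCircuits ℂ)) :
    HasEfficientEquations ℂ (SmallDefinable ℂ) ∨ BarrierLever.NaturalProofsSeparateVNP := by
  by_cases hS : BarrierLever.NaturalProofsSeparateVNP
  · exact Or.inr hS
  · exact Or.inl (hasEfficientEquations_smallDefinable_of_not_naturalProofsSeparateVNP hS heq)

/-- The same door with CKRST Question 1.4 (frame `d = n`, t20's `CKRST2020_question4_frame`) as the
`VP`-side hypothesis (`NPCorpusChainTyped.question4_frame_iff_hasEfficientEquations`).
[cite: ChatterjeeKumarRamyaSaptharishiTengse2020, Question 1.4] [cite: KumarRamyaSaptharishiTengse2022, Def. 4] -/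
theorem naturalProofsSeparateVNP_of_question4_frame_of_not_hasEfficientEquations
    (hQ : CKRST2020_question4_frame) (hno : ¬ HasEfficientEquations ℂ (SmallDefinable ℂ)) :
    BarrierLever.NaturalProofsSeparateVNP :=
  naturalProofsSeparateVNP_of_hasEfficientEquations
    (NPCorpusChainTyped.question4_frame_iff_hasEfficientEquations.1 hQ) hno

/-! ### §3 Infinitely-often hardness of the permanent suffices on the uniform axis -/

/-- **Mixing lemma (equations a.e. × `VNP`-hitting i.o.).** A level-`a` family of equations for `VP`
in KRST's Def-4 sense (vanishing on every `SmallCircuits ℂ n b` EVENTUALLY) together with ONE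
exponent `b₁` such that `SmallDefinable ℂ n b₁` hits `Distinguishers ℂ n a'` for every `a'`
INFINITELY OFTEN (the conclusion of KRST's Main Theorem in its "infinitely often" reading,
`succinctHittingSetsFromVNP_io_of_permanentExpHardIO`) gives item 18972: at the hitting `n` beyond
the vanishing threshold, `P_n` is a separating natural proof of level `a`; then
`naturalProofsSeparateVNP_of_level`. [cite: KumarRamyaSaptharishiTengse2022, Def. 4 and §3.5 (concluding paragraph)] -/
theorem naturalProofsSeparateVNP_of_equations_of_io_hitting {a : ℕ}
    {P : (n : ℕ) → MvPolynomial (degLEMonomials n) ℂ}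
    (hP : ∃ n₁ : ℕ, ∀ n : ℕ, n₁ ≤ n → P n ≠ 0 ∧ P n ∈ Distinguishers ℂ n a)
    (hvan : ∀ b : ℕ, ∃ n₀ : ℕ, ∀ n : ℕ, n₀ ≤ n →
      ∀ f ∈ SmallCircuits ℂ n b, eval (coeffVector (degLEMonomials n) f) (P n) = 0)
    (hhit : ∃ b₁ : ℕ, ∀ a' n₀ : ℕ, ∃ n : ℕ, n₀ ≤ n ∧
      IsSuccinctHittingSet (degLEMonomials n) (SmallDefinable ℂ n b₁) (Distinguishers ℂ n a')) :
    BarrierLever.NaturalProofsSeparateVNP := by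
  obtain ⟨n₁, hn₁⟩ := hP
  obtain ⟨b₁, hb₁⟩ := hhit
  refine naturalProofsSeparateVNP_of_level a ⟨b₁, fun b n₀ => ?_⟩
  obtain ⟨n₂, hn₂⟩ := hvan b
  obtain ⟨n, hn, hit⟩ := hb₁ a (max (max n₀ n₁) n₂)
  have h₀ : n₀ ≤ n := ((le_max_left _ _).trans (le_max_left _ _)).trans hn
  have h₁ : n₁ ≤ n := ((le_max_right _ _).trans (le_max_left _ _)).trans hn
  have h₂ : n₂ ≤ n := (le_max_right _ _).trans hn
  obtain ⟨g, hg, hne⟩ := hit (P n) (hn₁ n h₁).2 (hn₁ n h₁).1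
  exact ⟨n, h₀, P n, ⟨(hn₁ n h₁).2, (hn₁ n h₁).1, hn₂ n h₂⟩, g, hg, hne⟩

/-- **The infinitely-often-hardness win–win.** If `VP` has efficiently constructible equations
(KRST Def. 4) and the permanent is exponentially hard INFINITELY OFTEN (`PermanentExpHardIO ℂ c`:
`2^j ≤ L(per_{j^c})` for infinitely many `j` — KRST §3.5's own reading "`Perm_m` is `2^{m^ε}`-hard
for infinitely many `m`"), then item 18972 holds. Compare the landed a.e. win–win
`NPCorpusChain.naturalProofsSeparateVNP_of_not_crux` (`PermanentExpHardWith` + the i.o. statement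
`¬ crux`): trading uniformity from the hardness side to the equations side is exactly what the
mixing lemma allows; with BOTH sides infinitely often nothing follows.
[cite: KumarRamyaSaptharishiTengse2022, Thm MainThm, Def. 4 and §3.5 (concluding paragraph)] -/
theorem naturalProofsSeparateVNP_of_hasEfficientEquations_of_permanentExpHardIO {c : ℕ}
    (heq : HasEfficientEquations ℂ (SmallCircuits ℂ)) (hper : PermanentExpHardIO ℂ c) :
    BarrierLever.NaturalProofsSeparateVNP :=
  naturalProofsSeparateVNP_of_hasEfficientEquations heq (KRST2022_not_hasEfficientEquations_VNP_io hper)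

/-- The same with CKRST Question 1.4 (frame) on the `VP` side: `CKRST2020_question4_frame` and
infinitely-often exponential hardness of the permanent give item 18972 (g0's
`naturalProofsSeparateVNP_of_question4_frame` assumed the almost-everywhere `PermanentExpHardWith`).
[cite: ChatterjeeKumarRamyaSaptharishiTengse2020, Question 1.4] [cite: KumarRamyaSaptharishiTengse2022, §3.5 (concluding paragraph)] -/
theorem naturalProofsSeparateVNP_of_question4_frame_of_permanentExpHardIO {c : ℕ}
    (hQ : CKRST2020_question4_frame) (hper : PermanentExpHardIO ℂ c) :
    BarrierLever.NaturalProofsSeparateVNP :=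
  naturalProofsSeparateVNP_of_hasEfficientEquations_of_permanentExpHardIO
    (NPCorpusChainTyped.question4_frame_iff_hasEfficientEquations.1 hQ) hper

/-- Unconditionally in the hardness: CKRST Question 1.4 (frame) yields item 18972 OR the permanent
fails to be exponentially hard even infinitely often, for every exponent `c` (sharpening
`naturalProofsSeparateVNP_or_not_hard_of_question4_frame`, which had `PermanentExpHardWith`).
[cite: ChatterjeeKumarRamyaSaptharishiTengse2020, Question 1.4] [cite: KumarRamyaSaptharishiTengse2022, §3.5] -/
theorem naturalProofsSeparateVNP_or_not_hardIO_of_question4_frame (hQ : CKRST2020_question4_frame) :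
    BarrierLever.NaturalProofsSeparateVNP ∨ ∀ c : ℕ, ¬ PermanentExpHardIO ℂ c := by
  by_cases h : ∃ c : ℕ, PermanentExpHardIO ℂ c
  · obtain ⟨c, hper⟩ := h
    exact Or.inl (naturalProofsSeparateVNP_of_question4_frame_of_permanentExpHardIO hQ hper)
  · push Not at h
    exact Or.inr h

/-! ### §4 Contrapositives: absent the item, KRST §4 Open Problem 1 as printed, from i.o. hardness -/

/-- **`¬` item 18972 ⟹ KRST §4 Open Problem 1 AS PRINTED, under infinitely-often hardness.** If the
item fails and `per_{j^c}` needs size `2^j` for infinitely many `j`, then `VP` has NO efficiently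
constructible equations in the sense of KRST Def. 4. (The landed `krstForVP_of_not_naturalProofsSeparateVNP`
gives the route's `KRSTForVP` — almost-everywhere hardness ⟹ the crux; `NPCorpusChainTyped.krstForVP_defFour`
turns that into printed OP1 under a.e. hardness. Here the hardness hypothesis is the weaker i.o. one
and the conclusion is the printed, uniform one.) [cite: KumarRamyaSaptharishiTengse2022, §4 Open Problem 1 and Def. 4] -/
theorem not_hasEfficientEquations_smallCircuits_of_not_naturalProofsSeparateVNP_of_permanentExpHardIO
    (hS : ¬ BarrierLever.NaturalProofsSeparateVNP) {c : ℕ} (hper : PermanentExpHardIO ℂ c) :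
    ¬ HasEfficientEquations ℂ (SmallCircuits ℂ) :=
  fun heq => hS (naturalProofsSeparateVNP_of_hasEfficientEquations_of_permanentExpHardIO heq hper)

/-- **`¬` item 18972 ⟹ (no Def-4 equations for `VNP` ⟹ none for `VP`).** Absent the item, the
printed conclusion of KRST's Main Theorem ("`VNP` does not have efficiently constructible equations")
already yields its `VP`-analogue (§4 Open Problem 1's conclusion), with no hardness hypothesis at all.
[cite: KumarRamyaSaptharishiTengse2022, §4 Open Problems 1 and 3] -/
theorem not_hasEfficientEquations_smallCircuits_of_not_naturalProofsSeparateVNP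
    (hS : ¬ BarrierLever.NaturalProofsSeparateVNP) (hno : ¬ HasEfficientEquations ℂ (SmallDefinable ℂ)) :
    ¬ HasEfficientEquations ℂ (SmallCircuits ℂ) :=
  fun heq => hno (hasEfficientEquations_smallDefinable_of_not_naturalProofsSeparateVNP hS heq)

/-- `VP` slices are `VNP` slices one exponent up (`n ≥ 1`): `f = boolSum (rename inl f)` over ZERO
Boolean variables, `L(rename inl f) ≤ L(f) ≤ n^b ≤ n^(b+1)`, `deg ≤ n ≤ n^(b+1)`.
[cite: KumarRamyaSaptharishiTengse2022, Def. 3] -/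
theorem smallCircuits_subset_smallDefinable_succ {n b : ℕ} (hn : 1 ≤ n) :
    SmallCircuits ℂ n b ⊆ SmallDefinable ℂ n (b + 1) := by
  rintro f ⟨hdeg, hcx⟩
  refine ⟨hdeg, 0, Nat.zero_le _, rename Sum.inl f, ?_, ?_, ?_⟩
  · exact (complexity_rename_le_holds' _ f).trans
      (hcx.trans (Nat.pow_le_pow_right hn (Nat.le_succ b)))
  · exact (totalDegree_rename_le _ _).trans (hdeg.trans (Nat.le_self_pow (Nat.succ_ne_zero b) n))
  · -- `boolSum` over `Fin 0 → Bool` (one summand) of `rename inl f` is `f`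
    unfold boolSum
    rw [Fintype.sum_unique, aeval_rename]
    exact (aeval_X_left_apply f).symm

/-- Equations for `VNP` (Def. 4) restrict to equations for `VP` — unconditionally (t21's
`HasEfficientEquations.anti` needs a slice-wise inclusion at the SAME exponent; here the exponent
shifts by one, absorbed by Def. 4's "for every `b`"). [cite: KumarRamyaSaptharishiTengse2022, Def. 4] -/
theorem hasEfficientEquations_smallCircuits_of_smallDefinable
    (h : HasEfficientEquations ℂ (SmallDefinable ℂ)) : HasEfficientEquations ℂ (SmallCircuits ℂ) := by
  obtain ⟨a, P, hP, hvan⟩ := h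
  refine ⟨a, P, hP, fun b => ?_⟩
  obtain ⟨n₀, hn₀⟩ := hvan (b + 1)
  refine ⟨max n₀ 1, fun n hn f hf => hn₀ n ((le_max_left _ _).trans hn) f ?_⟩
  exact smallCircuits_subset_smallDefinable_succ ((le_max_right _ _).trans hn) hf

/-- Equivalently: absent item 18972, "`VP` has efficiently constructible equations" and "`VNP` has
efficiently constructible equations" (KRST Def. 4) are EQUIVALENT statements.
[cite: KumarRamyaSaptharishiTengse2022, Def. 4 and §4] -/
theorem hasEfficientEquations_smallCircuits_iff_smallDefinable_of_not_naturalProofsSeparateVNP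
    (hS : ¬ BarrierLever.NaturalProofsSeparateVNP) :
    HasEfficientEquations ℂ (SmallCircuits ℂ) ↔ HasEfficientEquations ℂ (SmallDefinable ℂ) :=
  ⟨hasEfficientEquations_smallDefinable_of_not_naturalProofsSeparateVNP hS,
    hasEfficientEquations_smallCircuits_of_smallDefinable⟩

/-! ### §5 The uniformity square: under almost-everywhere hardness the ALMOST-EVERYWHERE item
### is KRST Def. 4 for `VP` (appended 2026-08-26, same seat)

With a.e. hardness of the permanent the tree has `S ↔ ¬ crux` (`naturalProofsSeparateVNP_iff_not_crux`:
the INFINITELY-OFTEN row). This section records the ALMOST-EVERYWHERE row: the a.e. form of the item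
at some level `a` — "one `b₁`; for every `b`, for ALL large `n`, a level-`a` natural proof against
`SmallCircuits ℂ n b` with a non-root in `SmallDefinable ℂ n b₁`" (written out; no definition) — is,
under `PermanentExpHardWith ℂ c m₀`, EQUIVALENT to `HasEfficientEquations ℂ (SmallCircuits ℂ)`
(KRST Def. 4 for `VP` = CKRST Q1.4 frame). Unconditionally it implies both Def. 4 for `VP` (diagonal
choice of `b`, the chain's `hasEfficientEquations_smallCircuits_iff`) and the item. -/

/-- **a.e. separation ⟹ KRST Def. 4 for `VP`** (forget the non-roots; FSV Thm. 4 turns each natural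
proof into non-hitting; the chain's diagonal argument `NPCorpusChainTyped.hasEfficientEquations_smallCircuits_iff`
assembles ONE family). [cite: KumarRamyaSaptharishiTengse2022, Def. 4] [cite: ForbesShpilkaVolk2018, Thm. 4] -/
theorem hasEfficientEquations_of_separate_ae {a b₁ : ℕ}
    (h : ∀ b : ℕ, ∃ n₀ : ℕ, ∀ n : ℕ, n₀ ≤ n →
      ∃ D, IsNaturalProof (degLEMonomials n) (SmallCircuits ℂ n b) (Distinguishers ℂ n a) D ∧
        ∃ g ∈ SmallDefinable ℂ n b₁, eval (coeffVector (degLEMonomials n) g) D ≠ 0) :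
    HasEfficientEquations ℂ (SmallCircuits ℂ) := by
  refine NPCorpusChainTyped.hasEfficientEquations_smallCircuits_iff.2 ⟨a, fun b => ?_⟩
  obtain ⟨n₀, hn₀⟩ := h b
  refine ⟨n₀, fun n hn => ?_⟩
  obtain ⟨D, hD, -⟩ := hn₀ n hn
  exact (exists_isNaturalProof_iff _ _ _).1 ⟨D, hD⟩

/-- **a.e. separation ⟹ the item** (a.e. ⟹ i.o., then the level is immaterial,
`naturalProofsSeparateVNP_of_level`). [cite: ForbesShpilkaVolk2018, Question 6] -/
theorem naturalProofsSeparateVNP_of_separate_ae {a b₁ : ℕ}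
    (h : ∀ b : ℕ, ∃ n₀ : ℕ, ∀ n : ℕ, n₀ ≤ n →
      ∃ D, IsNaturalProof (degLEMonomials n) (SmallCircuits ℂ n b) (Distinguishers ℂ n a) D ∧
        ∃ g ∈ SmallDefinable ℂ n b₁, eval (coeffVector (degLEMonomials n) g) D ≠ 0) :
    BarrierLever.NaturalProofsSeparateVNP := by
  refine naturalProofsSeparateVNP_of_level a ⟨b₁, fun b n₀ => ?_⟩
  obtain ⟨n₁, hn₁⟩ := h b
  exact ⟨max n₀ n₁, le_max_left _ _, hn₁ _ (le_max_right _ _)⟩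

/-- **KRST Def. 4 for `VP` + almost-everywhere hardness ⟹ a.e. separation** (the SAME Def-4 family
`P_n` is, for all large `n`, a separating natural proof: KRST's a.e. hitting theorem
`succinctHittingSetsFromVNP_of_permanentExpHard` supplies the `VNP` non-roots eventually).
[cite: KumarRamyaSaptharishiTengse2022, Thm MainThm and Def. 4] -/
theorem separate_ae_of_hasEfficientEquations_of_permanentExpHardWith {c m₀ : ℕ}
    (heq : HasEfficientEquations ℂ (SmallCircuits ℂ)) (hper : PermanentExpHardWith ℂ c m₀) :
    ∃ a b₁ : ℕ, ∀ b : ℕ, ∃ n₀ : ℕ, ∀ n : ℕ, n₀ ≤ n →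
      ∃ D, IsNaturalProof (degLEMonomials n) (SmallCircuits ℂ n b) (Distinguishers ℂ n a) D ∧
        ∃ g ∈ SmallDefinable ℂ n b₁, eval (coeffVector (degLEMonomials n) g) D ≠ 0 := by
  obtain ⟨a, P, ⟨n₁, hn₁⟩, hvan⟩ := heq
  obtain ⟨b₁, hb₁⟩ := succinctHittingSetsFromVNP_of_permanentExpHard hper
  obtain ⟨n₂, hn₂⟩ := hb₁ a
  refine ⟨a, b₁, fun b => ?_⟩
  obtain ⟨n₃, hn₃⟩ := hvan b
  refine ⟨max (max n₁ n₂) n₃, fun n hn => ?_⟩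
  have h₁ : n₁ ≤ n := ((le_max_left _ _).trans (le_max_left _ _)).trans hn
  have h₂ : n₂ ≤ n := ((le_max_right _ _).trans (le_max_left _ _)).trans hn
  have h₃ : n₃ ≤ n := (le_max_right _ _).trans hn
  obtain ⟨g, hg, hne⟩ := hn₂ n h₂ (P n) (hn₁ n h₁).2 (hn₁ n h₁).1
  exact ⟨P n, ⟨(hn₁ n h₁).2, (hn₁ n h₁).1, hn₃ n h₃⟩, g, hg, hne⟩

/-- **The a.e. row of the dictionary.** Under almost-everywhere exponential hardness of the
permanent, "the item almost everywhere, at some level" ⟺ "`VP` has efficiently constructible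
equations" (KRST Def. 4) — companion of the i.o. row `S ↔ ¬ crux`
(`naturalProofsSeparateVNP_iff_not_crux`). The two rows differ exactly by the a.e./i.o. gap between
Def. 4 for `VP` and the failure of FSV Question 6 (`NPCorpusChainTyped.io_not_hitting_of_eventually_not_hitting`).
[cite: KumarRamyaSaptharishiTengse2022, Def. 4 and §4] [cite: ForbesShpilkaVolk2018, Question 6] -/
theorem separate_ae_iff_hasEfficientEquations {c m₀ : ℕ} (hper : PermanentExpHardWith ℂ c m₀) :
    (∃ a b₁ : ℕ, ∀ b : ℕ, ∃ n₀ : ℕ, ∀ n : ℕ, n₀ ≤ n →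
      ∃ D, IsNaturalProof (degLEMonomials n) (SmallCircuits ℂ n b) (Distinguishers ℂ n a) D ∧
        ∃ g ∈ SmallDefinable ℂ n b₁, eval (coeffVector (degLEMonomials n) g) D ≠ 0) ↔
      HasEfficientEquations ℂ (SmallCircuits ℂ) :=
  ⟨fun ⟨_, _, h⟩ => hasEfficientEquations_of_separate_ae h,
    fun heq => separate_ae_of_hasEfficientEquations_of_permanentExpHardWith heq hper⟩

end Summit.ValiantsHypothesis.ValiantsHypothesis.Theorems.BarrierLever.NaturalProofsSeparateVNP

end
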